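import Literature.NumberTheory.NumberFields.EquivariantFrobeniusInvariance
import HarnessLib

/-!
# The equivariant Iwasawa lemma, IX: equivariant Artin reciprocity with the base hypothesis on the
# `S`-SPLIT class group (`Hom_Γ(H′_{B,S}, V) = 0`), i.e. Deo–Ray–Sujatha's (c2) AS PRINTED — PROVED

Topic `NumberTheory/NumberFields` (namespace = path, grouping sub-namespace `EquivariantIwasawaLemma`).
THEOREM-ONLY file (no definition, no named fact, no `sorry`), written by the literature seat
`bsd-potss-conjA-anchor` g17 (cell `bsd-potss`; serves the asides stmt-BirchSwinnertonDyer-19386 / 19413;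
closes nothing).  The `S`-refinement of file III
(`EquivariantIwasawaLemmaClassGroup.inertiaTrivialHom_eq_zero_of_classGroupHom_eq_zero`):

* **`inertiaTrivialHom_eq_zero_of_classGroupHom_eq_zero_of_splitAt`** — `k ⊆ B ⊆ F` number fields, `F/k`
  and `B/k` Galois, `F/B` unramified at infinity; `Γ ↠ Gal(F/k)` via `π`, `V` a `Γ`-module; a set `bad` of
  finite places of `B` such that (c3*) `V^{Stab_Γ(𝔓)} = 0` for every prime `𝔓` of `F` above a bad place.
  IF every `Γ`-equivariant additive `μ : Cl(𝓞_B) → V` WHICH KILLS THE CLASSES OF THE BAD PRIMES is zero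
  (`Hom_Γ(H′_{B,bad}, V) = 0`, the printed hypothesis (c2) of Deo–Ray–Sujatha 2023 Thm. 3.8, there with
  `bad = S`), THEN every additive `χ : Gal(H_F/B) → V` killing all inertia groups and `Γ`-equivariant is zero.
  PROOF = the proof of file III verbatim (fixed field `P` of `ker χ`, abelian and everywhere unramified over
  `B`, embedded into `H_B`; `μ = χ ∘ lift ∘ Artin`), plus ONE new step showing that this `μ` kills the bad
  classes: by the Artin reciprocity of the tree (`artinEquiv_mk0_eq_of_isArithFrobAt`) the class of a bad `v`
  is a Frobenius of `H_B/B`, which restricts/transports to a Frobenius `w` of `P/B` above `v`; a Frobenius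
  `g₂` of `H_F/B` at a prime `𝔔 ∣ v` restricts to a Frobenius of `P/B` above `v`, equal to `w` because `P/B`
  is abelian and unramified at `v` (tree `eq_of_isArithFrobAt_of_commute`); so `μ[v] = χ(g₂)`, and
  `χ(g₂) = 0` by the decomposition invariance of file VIII (`apply_eq_zero_of_isArithFrobAt`) and (c3*) at
  `𝔔 ∩ F`.
* With `bad = ∅` this is file III again; composed with file II's group step it gives the `S`-version of the
  equivariant Iwasawa lemma (successor work: the absolute/tower/elliptic transports of files IV–VII and
  the discharge of `DeoRaySujatha2023.thm39_fineSelmerDual_moduleFinite_of_homTrivial_divisionField`).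

## References

* D. A. Cox, *Primes of the form x² + ny²*, 2nd ed. (2013), §8.A Thm. 8.10, §5.C Cor. 5.24. [Cox2013]
* J. Neukirch, *Algebraic Number Theory* (1999), Ch. VI (6.9), (7.1); Ch. IV §6; Ch. I §9. [NeukirchANT1999]
* S. V. Deo, A. Ray, R. Sujatha, Pure Appl. Math. Q. 19 (2023), §3 Thm. 3.8 (c2), (c3) and the definition of
  `H′_L` (arXiv:2202.09937 p. 9). [DeoRaySujatha2023]
-/

noncomputable section

open scoped Pointwise commutatorElement nonZeroDivisors
open NumberField IsDedekindDomain Ideal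

namespace Literature.NumberTheory.NumberFields

namespace EquivariantIwasawaLemma

open Literature.NumberTheory.NumberFields.hilbertClassField Literature.NumberTheory.GaloisRepresentations

section ClassGroupS

variable {k B F : Type} [Field k] [Field B] [NumberField B] [Field F] [NumberField F]
  [Algebra k B] [Algebra k F] [Algebra B F] [IsScalarTower k B F] [IsGalois k F] [IsGalois k B]
  [IsUnramifiedAtInfinitePlaces B F]

omit [NumberField B] [NumberField F] [Algebra k F] [Algebra B F] [IsScalarTower k B F] [IsGalois k F]
  [IsUnramifiedAtInfinitePlaces B F] in
/-- `g̃⁻¹` moves `B` by `(g̃|_B)⁻¹`. [folklore] -/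
private theorem symm_algebraMap'' {E : Type*} [Field E] [Algebra k E] [Algebra B E] [IsScalarTower k B E]
    (g : E ≃ₐ[k] E) (x : B) :
    g.symm (algebraMap B E x) = algebraMap B E ((g.restrictNormal B).symm x) := by
  apply g.injective
  rw [AlgEquiv.apply_symm_apply, ← AlgEquiv.restrictNormal_commutes, AlgEquiv.apply_symm_apply]

omit [NumberField B] [NumberField F] [Algebra k F] [Algebra B F] [IsScalarTower k B F] [IsGalois k F]
  [IsUnramifiedAtInfinitePlaces B F] in
/-- For `g̃ ∈ Aut(E/k)` and `σ ∈ Aut(E/B)` (`B/k` normal) the conjugate `g̃ σ g̃⁻¹` is `B`-linear.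
[folklore] -/
private theorem exists_conj'' {E : Type*} [Field E] [Algebra k E] [Algebra B E] [IsScalarTower k B E]
    (g : E ≃ₐ[k] E) (σ : E ≃ₐ[B] E) :
    ∃ σ' : E ≃ₐ[B] E, ∀ y, σ' y = g (σ (g.symm y)) := by
  refine ⟨AlgEquiv.ofRingEquiv (f := g.symm.toRingEquiv.trans (σ.toRingEquiv.trans g.toRingEquiv))
    fun x => ?_, fun y => rfl⟩
  change g (σ (g.symm (algebraMap B E x))) = algebraMap B E x
  rw [symm_algebraMap'', AlgEquiv.commutes, ← AlgEquiv.restrictNormal_commutes, AlgEquiv.apply_symm_apply]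

set_option maxHeartbeats 3000000 in
/-- **Galois side from the `S`-split class-group side.**  `k ⊆ B ⊆ F` number fields, `F/k` and `B/k`
Galois, `F/B` unramified at the infinite places; `Γ` acts on `V` through `π : Γ ↠ Gal(F/k)`; `bad` a set of
finite places of `B` with (c3*) «no non-zero vector of `V` is fixed by `{τ : π τ • 𝔓 = 𝔓}`» for every
prime `𝔓` of `F` above a bad place.  If every `Γ`-equivariant additive `μ : Cl(𝓞_B) → V` that kills the
classes `[v]` of the bad places is zero, then every additive `χ : Gal(H_F/B) → V` killing all inertia groups
and `Γ`-equivariant under conjugation is zero.  See the module docstring for the proof.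
[cite: Cox2013, §8.A Thm. 8.10 and §5.C Cor. 5.24]
[cite: NeukirchANT1999, Ch. VI (6.9), (7.1), Ch. IV §6 and Ch. I §9 (9.4)–(9.6)]
[cite: DeoRaySujatha2023, §3 Thm. 3.8 (c2) and the definition of H′_L (arXiv:2202.09937 p. 9)] -/
theorem inertiaTrivialHom_eq_zero_of_classGroupHom_eq_zero_of_splitAt
    {Γ : Type*} [Group Γ] (π : Γ →* (F ≃ₐ[k] F)) (hπ : Function.Surjective π)
    {V : Type*} [AddCommGroup V] [DistribMulAction Γ V]
    (bad : HeightOneSpectrum (𝓞 B) → Prop)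
    (hD : ∀ (𝔓 : Ideal (𝓞 F)) [𝔓.IsMaximal] (v : HeightOneSpectrum (𝓞 B)), bad v →
      𝔓.under (𝓞 B) = v.asIdeal → ∀ x : V, (∀ τ : Γ, π τ • 𝔓 = 𝔓 → τ • x = x) → x = 0)
    (h0 : ∀ μ : Additive (ClassGroup (𝓞 B)) →+ V,
      (∀ (τ : Γ) (c : ClassGroup (𝓞 B)),
        μ (Additive.ofMul (ClassGroup.mulEquiv (AmbiguousClass.intAut ((π τ).restrictNormal B)) c)) =
          τ • μ (Additive.ofMul c)) →
      (∀ v : HeightOneSpectrum (𝓞 B), bad v →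
        μ (Additive.ofMul (ClassGroup.mk0 ⟨v.asIdeal, mem_nonZeroDivisors_of_ne_zero v.ne_bot⟩)) = 0) →
      μ = 0)
    (χ : (hilbertClassField F ≃ₐ[B] hilbertClassField F) → V)
    (hχadd : ∀ a b, χ (a * b) = χ a + χ b)
    (hχI : ∀ (Q : Ideal (𝓞 (hilbertClassField F))) [Q.IsMaximal],
      ∀ s ∈ Q.inertia (hilbertClassField F ≃ₐ[B] hilbertClassField F), χ s = 0)
    (hχequiv : ∀ (τ : Γ) (g : hilbertClassField F ≃ₐ[k] hilbertClassField F)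
      (a a' : hilbertClassField F ≃ₐ[B] hilbertClassField F),
      AlgEquiv.restrictNormalHom F g = π τ → (∀ y, a' y = g (a (g.symm y))) → χ a' = τ • χ a)
    (a : hilbertClassField F ≃ₐ[B] hilbertClassField F) : χ a = 0 := by
  classical
  -- ### Galois setup
  haveI : CharZero k := (algebraMap k F).charZero
  haveI : FiniteDimensional k F := Module.Finite.of_restrictScalars_finite ℚ k F
  haveI : FiniteDimensional k B := Module.Finite.of_restrictScalars_finite ℚ k B
  haveI : IsGalois B F := IsGalois.tower_top_of_isGalois k B F
  haveI : IsScalarTower k F (hilbertClassField F) :=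
    IsScalarTower.of_algebraMap_eq fun x => Subtype.ext (IsScalarTower.algebraMap_apply k F _ x)
  haveI : IsScalarTower B F (hilbertClassField F) :=
    IsScalarTower.of_algebraMap_eq fun x => Subtype.ext (IsScalarTower.algebraMap_apply B F _ x)
  haveI : IsScalarTower k B (hilbertClassField F) := IsScalarTower.of_algebraMap_eq fun x => by
    rw [IsScalarTower.algebraMap_apply B F (hilbertClassField F),
      ← IsScalarTower.algebraMap_apply k B F, ← IsScalarTower.algebraMap_apply k F (hilbertClassField F)]
  haveI : IsGalois k (hilbertClassField F) := hilbertClassField.isGalois_of_isGalois F (K := k)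
  haveI : IsGalois B (hilbertClassField F) := hilbertClassField.isGalois_of_isGalois F (K := B)
  haveI : FiniteDimensional B (hilbertClassField F) := Module.Finite.trans F (hilbertClassField F)
  haveI : IsUnramifiedAtInfinitePlaces B (hilbertClassField F) :=
    IsUnramifiedAtInfinitePlaces.trans B F (hilbertClassField F)
  haveI : IsGalois k (hilbertClassField B) := hilbertClassField.isGalois_of_isGalois B (K := k)
  obtain ⟨rk, hrk⟩ : ∃ rk : (hilbertClassField F ≃ₐ[k] hilbertClassField F) →* (F ≃ₐ[k] F),
      rk = AlgEquiv.restrictNormalHom F := ⟨_, rfl⟩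
  have hrk_apply : ∀ g x, algebraMap F (hilbertClassField F) (rk g x) = g (algebraMap F _ x) := by
    intro g x; rw [hrk]; exact AlgEquiv.restrictNormal_commutes g F x
  have hrk_surj : Function.Surjective rk := by
    rw [hrk]; exact AlgEquiv.restrictNormalHom_surjective (hilbertClassField F)
  have hχ1 : χ 1 = 0 := by
    have h := hχadd 1 1; rw [mul_one] at h; exact left_eq_add.mp h
  -- ### `K = ker χ`, a normal subgroup containing commutators and inertia, stable under `Gal(H_F/k)`
  let χ' : (hilbertClassField F ≃ₐ[B] hilbertClassField F) →* Multiplicative V :=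
    { toFun := fun a => Multiplicative.ofAdd (χ a)
      map_one' := by rw [hχ1]; rfl
      map_mul' := fun a b => by rw [hχadd]; rfl }
  obtain ⟨K, hK⟩ : ∃ K : Subgroup (hilbertClassField F ≃ₐ[B] hilbertClassField F), K = χ'.ker := ⟨_, rfl⟩
  have hmemK : ∀ x, x ∈ K ↔ χ x = 0 := fun x => by
    rw [hK, MonoidHom.mem_ker]; exact ofAdd_eq_one
  haveI hKn : K.Normal := by rw [hK]; infer_instance
  have hcommK : ⁅(⊤ : Subgroup (hilbertClassField F ≃ₐ[B] hilbertClassField F)), ⊤⁆ ≤ K := by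
    rw [Subgroup.commutator_le]
    intro g _ h _
    rw [hK, MonoidHom.mem_ker, map_commutatorElement, commutatorElement_eq_one_iff_mul_comm, mul_comm]
  have hIK : ∀ (Q : Ideal (𝓞 (hilbertClassField F))) [Q.IsMaximal],
      Q.inertia (hilbertClassField F ≃ₐ[B] hilbertClassField F) ≤ K :=
    fun Q _ s hs => (hmemK s).mpr (hχI Q s hs)
  have hKconj : ∀ (g : hilbertClassField F ≃ₐ[k] hilbertClassField F)
      (n n' : hilbertClassField F ≃ₐ[B] hilbertClassField F),
      n ∈ K → (∀ y, n' y = g (n (g.symm y))) → n' ∈ K := by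
    intro g n n' hn hn'
    obtain ⟨τ, hτ⟩ := hπ (rk g)
    rw [hmemK] at hn ⊢
    rw [hχequiv τ g n n' (by rw [← hrk, hτ]) hn', hn, smul_zero]
  -- ### the fixed field `P` of `K`: abelian, unramified, `Gal(H_F/k)`-stable
  obtain ⟨P, hP⟩ : ∃ P : IntermediateField B (hilbertClassField F), P = IntermediateField.fixedField K :=
    ⟨_, rfl⟩
  haveI : IsGalois B P := by rw [hP]; exact IsGalois.of_fixedField_normal_subgroup K
  haveI : NumberField P := NumberField.of_module_finite B P
  have hPfix : P.fixingSubgroup = K := by rw [hP, IntermediateField.fixingSubgroup_fixedField]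
  -- `Gal(H_F/B) → Gal(P/B)` with kernel `K`
  obtain ⟨resP, hresP⟩ : ∃ resP : (hilbertClassField F ≃ₐ[B] hilbertClassField F) →* (P ≃ₐ[B] P),
      resP = AlgEquiv.restrictNormalHom P := ⟨_, rfl⟩
  have hresP_val : ∀ g (x : P), ((resP g x : P) : hilbertClassField F) = g (x : hilbertClassField F) := by
    intro g x; rw [hresP]; exact AlgEquiv.restrictNormal_commutes g P x
  have hresP_surj : Function.Surjective resP := by
    rw [hresP]; exact AlgEquiv.restrictNormalHom_surjective (hilbertClassField F)
  have hresP_K : ∀ n, n ∈ K → resP n = 1 := by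
    intro n hn
    rw [← hPfix, IntermediateField.mem_fixingSubgroup_iff] at hn
    apply AlgEquiv.ext
    intro x
    apply Subtype.ext
    rw [hresP_val, AlgEquiv.one_apply]
    exact hn x x.2
  have hresP_ker : ∀ g g', resP g = resP g' → χ g = χ g' := by
    intro g g' h
    have hmem : g⁻¹ * g' ∈ K := by
      rw [← hPfix, IntermediateField.mem_fixingSubgroup_iff]
      intro x hx
      have h1 : g' x = g x := by
        rw [← hresP_val g' ⟨x, hx⟩, ← hresP_val g ⟨x, hx⟩, h]
      rw [AlgEquiv.mul_apply, h1, AlgEquiv.aut_inv, AlgEquiv.symm_apply_apply]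
    have : g' = g * (g⁻¹ * g') := by group
    rw [this, hχadd, (hmemK _).mp hmem, add_zero]
  haveI : IsAbelianGalois B P := by
    refine { is_comm := ⟨fun x y => ?_⟩ }
    obtain ⟨g, rfl⟩ := hresP_surj x
    obtain ⟨g', rfl⟩ := hresP_surj y
    rw [← map_mul, ← map_mul]
    have hk : g * g' * (g' * g)⁻¹ ∈ K := by
      apply hcommK
      have : g * g' * (g' * g)⁻¹ = ⁅g, g'⁆ := by rw [commutatorElement_def]; group
      rw [this]
      exact Subgroup.commutator_mem_commutator (Subgroup.mem_top g) (Subgroup.mem_top g')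
    have hk' := hresP_K _ hk
    rwa [map_mul, map_inv, mul_inv_eq_one] at hk'
  haveI : IsUnramifiedAtInfinitePlaces B P :=
    isUnramifiedAtInfinitePlaces_of_algHom (IsScalarTower.toAlgHom B P (hilbertClassField F))
  have hunrP : ∀ v : HeightOneSpectrum (𝓞 B), Algebra.IsUnramifiedIn (𝓞 P) v.asIdeal := by
    intro v q hq hqv
    haveI := hq
    have hq0 : q ≠ ⊥ := by
      intro h0
      apply v.ne_bot
      rw [hqv.over, h0, Ideal.under_def, Ideal.comap_bot_of_injective _
        (FaithfulSMul.algebraMap_injective (𝓞 B) (𝓞 P))]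
    haveI : q.IsMaximal := hq.isMaximal hq0
    obtain ⟨Q, hQmax, hQq⟩ := Ideal.exists_maximal_ideal_liesOver_of_isIntegral (S := 𝓞 (hilbertClassField F)) q
    haveI := hQmax
    have hq' : q = Q.under (𝓞 P) := hQq.over
    subst hq'
    rw [isUnramifiedAt_under_iff_inertia_le' P Q, hPfix]
    exact hIK Q
  have hPstab : ∀ (g : hilbertClassField F ≃ₐ[k] hilbertClassField F) (x : hilbertClassField F),
      x ∈ P → g x ∈ P := by
    intro g x hx
    rw [hP, IntermediateField.mem_fixedField_iff] at hx ⊢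
    intro n hn
    obtain ⟨n', hn'⟩ := exists_conj'' g.symm n
    have hn'K : n' ∈ K := hKconj g.symm n n' hn hn'
    have h := hx n' hn'K
    rw [hn', AlgEquiv.symm_symm] at h
    -- `g⁻¹ (n (g x)) = x`
    have h2 := congrArg g h
    rwa [AlgEquiv.apply_symm_apply] at h2
  -- ### embedding into `B̄` and the Hilbert class field of `B`
  let ψ : hilbertClassField F →ₐ[B] AlgebraicClosure B := IsAlgClosed.lift
  obtain ⟨Pb, hPb⟩ : ∃ Pb : IntermediateField B (AlgebraicClosure B), Pb = P.map ψ := ⟨_, rfl⟩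
  let e : P ≃ₐ[B] Pb := (IntermediateField.equivMap P ψ).trans (IntermediateField.equivOfEq hPb.symm)
  have he_val : ∀ x : P, ((e x : Pb) : AlgebraicClosure B) = ψ (x : hilbertClassField F) := fun _ => rfl
  haveI : FiniteDimensional B Pb := LinearEquiv.finiteDimensional e.toLinearEquiv
  haveI : NumberField Pb := NumberField.of_module_finite B Pb
  haveI : IsAbelianGalois B Pb := IsAbelianGalois.of_algHom (e.symm : Pb →ₐ[B] P)
  haveI : IsUnramifiedAtInfinitePlaces B Pb := isUnramifiedAtInfinitePlaces_of_algHom (e.symm : Pb →ₐ[B] P)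
  have hunrPb := forall_isUnramifiedIn_of_algHom (e.symm : Pb →ₐ[B] P) hunrP
  have hle : Pb ≤ hilbertClassField B := le_hilbertClassField B Pb hunrPb
  -- `Gal(H_B/B) → Gal(P♭/B)`
  letI algPb : Algebra Pb (hilbertClassField B) := (IntermediateField.inclusion hle).toRingHom.toAlgebra
  haveI : IsScalarTower B Pb (hilbertClassField B) := IsScalarTower.of_algebraMap_eq fun _ => rfl
  have hincl_val : ∀ y : Pb, ((algebraMap Pb (hilbertClassField B) y : hilbertClassField B) :
      AlgebraicClosure B) = (y : AlgebraicClosure B) := fun _ => rfl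
  obtain ⟨resPb, hresPb⟩ : ∃ resPb : (hilbertClassField B ≃ₐ[B] hilbertClassField B) →* (Pb ≃ₐ[B] Pb),
      resPb = AlgEquiv.restrictNormalHom Pb := ⟨_, rfl⟩
  have hresPb_val : ∀ h (y : Pb), ((resPb h y : Pb) : AlgebraicClosure B) =
      ((h (algebraMap Pb (hilbertClassField B) y) : hilbertClassField B) : AlgebraicClosure B) := by
    intro h y
    rw [← hincl_val (resPb h y), hresPb]
    exact congrArg (fun z : hilbertClassField B => (z : AlgebraicClosure B))
      (AlgEquiv.restrictNormal_commutes h Pb y)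
  have hresPb_surj : Function.Surjective resPb := by
    rw [hresPb]; exact AlgEquiv.restrictNormalHom_surjective (hilbertClassField B)
  -- the transported functional `ν` on `Gal(P/B)` and `μ` on `Cl(B)`
  let L : (P ≃ₐ[B] P) → (hilbertClassField F ≃ₐ[B] hilbertClassField F) := Function.surjInv hresP_surj
  have hL : ∀ w, resP (L w) = w := Function.surjInv_eq hresP_surj
  let eaut : (P ≃ₐ[B] P) ≃* (Pb ≃ₐ[B] Pb) := e.autCongr
  have heaut : ∀ w y, eaut w y = e (w (e.symm y)) := fun _ _ => rfl
  let μ : ClassGroup (𝓞 B) → V := fun c => χ (L (eaut.symm (resPb (artinEquiv B c))))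
  have hμ_of : ∀ c g, resP g = eaut.symm (resPb (artinEquiv B c)) → μ c = χ g := by
    intro c g hg
    exact hresP_ker _ _ (by rw [hL, hg])
  have hμmul : ∀ c c', μ (c * c') = μ c + μ c' := by
    intro c c'
    rw [hμ_of (c * c') (L (eaut.symm (resPb (artinEquiv B c))) * L (eaut.symm (resPb (artinEquiv B c'))))
      (by rw [map_mul, hL, hL, map_mul, map_mul, map_mul]), hχadd]
  let μ' : Additive (ClassGroup (𝓞 B)) →+ V :=
    AddMonoidHom.mk' (fun c => μ (Additive.toMul c)) fun c c' => by
      rw [toMul_add, hμmul]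
  -- ### equivariance of `μ`
  have hμequiv : ∀ (τ : Γ) (c : ClassGroup (𝓞 B)),
      μ' (Additive.ofMul (ClassGroup.mulEquiv (AmbiguousClass.intAut ((π τ).restrictNormal B)) c)) =
        τ • μ' (Additive.ofMul c) := by
    intro τ c
    simp only [μ', AddMonoidHom.mk'_apply, toMul_ofMul]
    -- the element `a₀` computing `μ c`, and its conjugate
    obtain ⟨a₀, ha₀⟩ : ∃ a₀, a₀ = L (eaut.symm (resPb (artinEquiv B c))) := ⟨_, rfl⟩
    have hμc : μ c = χ a₀ := by rw [ha₀]
    have ha₀r : resP a₀ = eaut.symm (resPb (artinEquiv B c)) := by rw [ha₀, hL]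
    have hPbArt : resPb (artinEquiv B c) = eaut (resP a₀) := by rw [ha₀r, MulEquiv.apply_symm_apply]
    -- `ω ∈ Aut(B̄/k)` over `π τ`, its restrictions `τ̃` to `H_B` and `g̃` to `H_F`
    let ψF : F →ₐ[B] AlgebraicClosure B := ψ.comp (IsScalarTower.toAlgHom B F (hilbertClassField F))
    letI algF : Algebra F (AlgebraicClosure B) := ψF.toRingHom.toAlgebra
    haveI : IsScalarTower B F (AlgebraicClosure B) := IsScalarTower.of_algebraMap_eq fun x => (ψF.commutes x).symm
    haveI : IsScalarTower k F (AlgebraicClosure B) := IsScalarTower.of_algebraMap_eq fun x => by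
      rw [IsScalarTower.algebraMap_apply k B (AlgebraicClosure B), IsScalarTower.algebraMap_apply k B F,
        ← IsScalarTower.algebraMap_apply B F (AlgebraicClosure B)]
    letI algH : Algebra (hilbertClassField F) (AlgebraicClosure B) := ψ.toRingHom.toAlgebra
    haveI : IsScalarTower B (hilbertClassField F) (AlgebraicClosure B) :=
      IsScalarTower.of_algebraMap_eq fun x => (ψ.commutes x).symm
    haveI : IsScalarTower k (hilbertClassField F) (AlgebraicClosure B) :=
      IsScalarTower.of_algebraMap_eq fun x => by
        rw [IsScalarTower.algebraMap_apply k B (AlgebraicClosure B), IsScalarTower.algebraMap_apply k B (hilbertClassField F),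
          ← IsScalarTower.algebraMap_apply B (hilbertClassField F) (AlgebraicClosure B)]
    haveI : IsScalarTower F (hilbertClassField F) (AlgebraicClosure B) :=
      IsScalarTower.of_algebraMap_eq fun x => rfl
    haveI : Algebra.IsAlgebraic k B := Algebra.IsAlgebraic.of_finite k B
    haveI : Normal k (AlgebraicClosure B) := IsAlgClosure.normal k (AlgebraicClosure B)
    let ω : AlgebraicClosure B ≃ₐ[k] AlgebraicClosure B := (π τ).liftNormal (AlgebraicClosure B)
    have hω : ∀ x : F, ω (ψF x) = ψF (π τ x) := fun x => AlgEquiv.liftNormal_commutes (π τ) _ x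
    haveI : Normal k (hilbertClassField B) := inferInstance
    haveI : IsScalarTower k (hilbertClassField B) (AlgebraicClosure B) :=
      IsScalarTower.of_algebraMap_eq fun _ => rfl
    let τt : hilbertClassField B ≃ₐ[k] hilbertClassField B := ω.restrictNormal (hilbertClassField B)
    have hτt_val : ∀ z : hilbertClassField B, ((τt z : hilbertClassField B) : AlgebraicClosure B) =
        ω (z : AlgebraicClosure B) := fun z => AlgEquiv.restrictNormal_commutes ω (hilbertClassField B) z
    have hτtsymm_val : ∀ z : hilbertClassField B, ((τt.symm z : hilbertClassField B) : AlgebraicClosure B) =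
        ω.symm (z : AlgebraicClosure B) := by
      intro z; apply ω.injective; rw [← hτt_val, AlgEquiv.apply_symm_apply, AlgEquiv.apply_symm_apply]
    let gt : hilbertClassField F ≃ₐ[k] hilbertClassField F := ω.restrictNormal (hilbertClassField F)
    have hgt_val : ∀ z : hilbertClassField F, ψ (gt z) = ω (ψ z) :=
      fun z => AlgEquiv.restrictNormal_commutes ω (hilbertClassField F) z
    have hgtsymm_val : ∀ z : hilbertClassField F, ψ (gt.symm z) = ω.symm (ψ z) := by
      intro z; apply ω.injective; rw [← hgt_val, AlgEquiv.apply_symm_apply, AlgEquiv.apply_symm_apply]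
    -- `g̃` restricts to `π τ` on `F`, `τ̃` restricts to `(π τ)|_B` on `B`
    have hgt_rk : AlgEquiv.restrictNormalHom F gt = π τ := by
      rw [← hrk]
      apply AlgEquiv.ext
      intro x
      have hψinj : Function.Injective (ψ : hilbertClassField F → AlgebraicClosure B) :=
        ψ.toRingHom.injective
      apply (algebraMap F (hilbertClassField F)).injective
      apply hψinj
      rw [hrk_apply, hgt_val]
      exact hω x
    have hτtB : ∀ b : B, τt (algebraMap B (hilbertClassField B) b) =
        algebraMap B (hilbertClassField B) ((π τ).restrictNormal B b) := by
      intro b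
      apply Subtype.ext
      rw [hτt_val]
      change ω (algebraMap B (AlgebraicClosure B) b) = algebraMap B (AlgebraicClosure B) ((π τ).restrictNormal B b)
      rw [IsScalarTower.algebraMap_apply B F (AlgebraicClosure B) b,
        IsScalarTower.algebraMap_apply B F (AlgebraicClosure B) ((π τ).restrictNormal B b),
        AlgEquiv.restrictNormal_commutes]
      exact hω (algebraMap B F b)
    -- the conjugate `a'` of `a₀` by `g̃`
    obtain ⟨a', ha'⟩ := exists_conj'' gt a₀
    have hχa' : χ a' = τ • χ a₀ := hχequiv τ gt a₀ a' hgt_rk ha'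
    rw [hμc, ← hχa']
    apply hμ_of
    -- ### the key identity `resP a' = eaut⁻¹ (resPb (Artin (τ • c)))`
    apply eaut.injective
    rw [MulEquiv.apply_symm_apply]
    apply AlgEquiv.ext
    intro y
    apply Subtype.ext
    -- write `y = e x`
    obtain ⟨x, rfl⟩ : ∃ x : P, e x = y := ⟨e.symm y, e.apply_symm_apply y⟩
    -- `τ̃⁻¹ (e x) = e (g̃⁻¹ x)` inside `H_B`
    have hx1 : gt.symm (x : hilbertClassField F) ∈ P := hPstab gt.symm x x.2
    have hstep : τt.symm (algebraMap Pb (hilbertClassField B) (e x)) =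
        algebraMap Pb (hilbertClassField B) (e ⟨gt.symm (x : hilbertClassField F), hx1⟩) := by
      apply Subtype.ext
      simp only [hτtsymm_val, hincl_val, he_val]
      exact (hgtsymm_val _).symm
    have lhs : ((eaut (resP a') (e x) : Pb) : AlgebraicClosure B) =
        ω (ψ (a₀ (gt.symm (x : hilbertClassField F)))) := by
      rw [heaut, AlgEquiv.symm_apply_apply, he_val, hresP_val, ha', hgt_val]
    rw [lhs]
    symm
    rw [hresPb_val, artinEquiv_mulEquiv_intAut_apply B τt ((π τ).restrictNormal B) hτtB c, hτt_val,
      hstep, ← hresPb_val, hPbArt, heaut, AlgEquiv.symm_apply_apply, he_val, hresP_val]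
  -- ### the classes of the `bad` primes are killed by `μ` (Frobenius + decomposition invariance)
  have hμS : ∀ v : HeightOneSpectrum (𝓞 B), bad v →
      μ' (Additive.ofMul (ClassGroup.mk0 ⟨v.asIdeal, mem_nonZeroDivisors_of_ne_zero v.ne_bot⟩)) = 0 := by
    intro v hv
    haveI := v.isMaximal
    simp only [μ', AddMonoidHom.mk'_apply, toMul_ofMul]
    -- (1) Artin: the class of `v` goes to a Frobenius `φ₀` of `H_B/B` at a prime `Q ∣ v`
    obtain ⟨Q, hQ, hφ₀⟩ := galFrob_spec B (hilbertClassField B) v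
    have hArt : artinEquiv B (ClassGroup.mk0 ⟨v.asIdeal, mem_nonZeroDivisors_of_ne_zero v.ne_bot⟩) =
        galFrob B (hilbertClassField B) v := artinEquiv_mk0_eq_of_isArithFrobAt B hQ hφ₀
    set φ₀ := galFrob B (hilbertClassField B) v with hφ₀def
    haveI := hQ.1
    haveI : Q.LiesOver v.asIdeal := hQ.2
    -- the common exponent `q = #(𝓞 B / v)`
    have hq : ∀ {S : Type} [CommRing S] [Algebra (𝓞 B) S] (J : Ideal S) [J.LiesOver v.asIdeal],
        Nat.card (𝓞 B ⧸ J.under (𝓞 B)) = Nat.card (𝓞 B ⧸ v.asIdeal) := by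
      intro S _ _ J hJ
      rw [← hJ.over]
    -- (2) `w = e⁻¹ ∘ (φ₀|_{P♭}) ∘ e` is a Frobenius of `P/B` at the prime `𝔭₁` transported from `Q`
    set w : P ≃ₐ[B] P := eaut.symm (resPb φ₀) with hwdef
    have hw_apply : ∀ x : P, w x = e.symm (resPb φ₀ (e x)) := fun x => rfl
    let θ : 𝓞 P →+* 𝓞 (hilbertClassField B) :=
      (algebraMap (𝓞 Pb) (𝓞 (hilbertClassField B))).comp
        (RingOfIntegers.mapRingEquiv e.toRingEquiv).toRingHom
    have hθ_val : ∀ x : 𝓞 P, ((θ x : 𝓞 (hilbertClassField B)) : hilbertClassField B) =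
        algebraMap Pb (hilbertClassField B) (e (x : P)) := fun _ => rfl
    have hθ_alg : ∀ b : 𝓞 B, θ (algebraMap (𝓞 B) (𝓞 P) b) = algebraMap (𝓞 B) (𝓞 (hilbertClassField B)) b := by
      intro b
      apply RingOfIntegers.coe_injective
      change ((θ (algebraMap (𝓞 B) (𝓞 P) b) : 𝓞 (hilbertClassField B)) : hilbertClassField B) =
        ((algebraMap (𝓞 B) (𝓞 (hilbertClassField B)) b : 𝓞 (hilbertClassField B)) : hilbertClassField B)
      rw [hθ_val]
      change algebraMap Pb (hilbertClassField B) (e (algebraMap B P (b : B))) =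
        algebraMap B (hilbertClassField B) (b : B)
      rw [AlgEquiv.commutes, ← IsScalarTower.algebraMap_apply]
    have hθcomp : θ.comp (algebraMap (𝓞 B) (𝓞 P)) = algebraMap (𝓞 B) (𝓞 (hilbertClassField B)) :=
      RingHom.ext fun b => hθ_alg b
    set 𝔭₁ : Ideal (𝓞 P) := Q.comap θ with h𝔭₁def
    haveI : 𝔭₁.IsPrime := Ideal.IsPrime.comap θ
    have h𝔭₁under : 𝔭₁.under (𝓞 B) = v.asIdeal := by
      rw [hQ.2.over, Ideal.under_def, Ideal.under_def, h𝔭₁def, Ideal.comap_comap, hθcomp]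
    haveI : 𝔭₁.LiesOver v.asIdeal := ⟨h𝔭₁under.symm⟩
    have h𝔭₁ : 𝔭₁ ∈ v.asIdeal.primesOver (𝓞 P) := ⟨inferInstance, inferInstance⟩
    have hw : IsArithFrobAt (𝓞 B) w 𝔭₁ := by
      intro x
      rw [hq 𝔭₁, ← hq Q, MulSemiringAction.toAlgHom_apply, h𝔭₁def, Ideal.mem_comap, map_sub, map_pow]
      have hθw : θ (w • x) = φ₀ • θ x := by
        apply RingOfIntegers.coe_injective
        change ((θ (w • x) : 𝓞 (hilbertClassField B)) : hilbertClassField B) =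
          ((φ₀ • θ x : 𝓞 (hilbertClassField B)) : hilbertClassField B)
        have e2 : ((φ₀ • θ x : 𝓞 (hilbertClassField B)) : hilbertClassField B) =
            φ₀ ((θ x : 𝓞 (hilbertClassField B)) : hilbertClassField B) := rfl
        have e3 : ((w • x : 𝓞 P) : P) = w (x : P) := rfl
        rw [e2, hθ_val, hθ_val, e3, hw_apply, AlgEquiv.apply_symm_apply]
        apply Subtype.ext
        rw [hincl_val, hresPb_val]
      rw [hθw]
      exact hφ₀ (θ x)
    -- (3) a Frobenius `g₂` of `H_F/B` at a prime `𝔔 ∣ v`; its restriction to `P` is a Frobenius at `𝔔 ∩ P`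
    obtain ⟨𝔔, h𝔔max, h𝔔v⟩ :=
      Ideal.exists_maximal_ideal_liesOver_of_isIntegral (S := 𝓞 (hilbertClassField F)) v.asIdeal
    haveI := h𝔔max
    haveI := h𝔔v
    have h𝔔0 : 𝔔 ≠ ⊥ := Ring.ne_bot_of_isMaximal_of_not_isField h𝔔max
      (RingOfIntegers.not_isField (hilbertClassField F))
    obtain ⟨g₂, hg₂⟩ := exists_isArithFrobAt_ringOfIntegers (M := B) 𝔔 h𝔔0
    set 𝔭 : Ideal (𝓞 P) := 𝔔.under (𝓞 P) with h𝔭def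
    haveI : 𝔭.IsPrime := Ideal.IsPrime.under (𝓞 P) 𝔔
    have h𝔭under : 𝔭.under (𝓞 B) = v.asIdeal := by
      rw [h𝔭def, Ideal.under_under, ← h𝔔v.over]
    haveI : 𝔭.LiesOver v.asIdeal := ⟨h𝔭under.symm⟩
    have h𝔭 : 𝔭 ∈ v.asIdeal.primesOver (𝓞 P) := ⟨inferInstance, inferInstance⟩
    have hres : IsArithFrobAt (𝓞 B) (resP g₂) 𝔭 := by
      intro x
      rw [hq 𝔭, ← hq 𝔔, MulSemiringAction.toAlgHom_apply, h𝔭def, Ideal.under_def, Ideal.mem_comap,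
        map_sub, map_pow]
      have h1 : algebraMap (𝓞 P) (𝓞 (hilbertClassField F)) (resP g₂ • x) =
          g₂ • algebraMap (𝓞 P) (𝓞 (hilbertClassField F)) x := by
        apply RingOfIntegers.coe_injective
        change (((resP g₂ • x : 𝓞 P) : P) : hilbertClassField F) =
          ((g₂ • algebraMap (𝓞 P) (𝓞 (hilbertClassField F)) x : 𝓞 (hilbertClassField F)) :
            hilbertClassField F)
        exact hresP_val g₂ (x : P)
      rw [h1]
      exact hg₂ _
    -- (4) `P/B` abelian and unramified: the two Frobenii over `v` coincide
    have hcommP : ∀ a b : P ≃ₐ[B] P, Commute a b := fun a b => IsMulCommutative.is_comm.comm a b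
    have hwg : resP g₂ = w := eq_of_isArithFrobAt_of_commute (hunrP v) hcommP h𝔭₁ h𝔭 hw hres
    -- (5) `χ g₂ = 0` by the decomposition invariance at `𝔔`, and `μ[v] = χ g₂`
    haveI : (𝔔.under (𝓞 F)).IsMaximal := Ideal.IsMaximal.under (𝓞 F) 𝔔
    have hbad : (𝔔.under (𝓞 F)).under (𝓞 B) = v.asIdeal := by
      rw [Ideal.under_under, ← h𝔔v.over]
    have hχg₂ : χ g₂ = 0 :=
      apply_eq_zero_of_isArithFrobAt π χ hχadd (fun Q' _ => hχI Q') hχequiv 𝔔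
        (hD (𝔔.under (𝓞 F)) v hv hbad) g₂ hg₂
    rw [hμ_of _ g₂ (by rw [hwg, hArt]), hχg₂]
  -- ### conclusion
  have hμ0 : μ' = 0 := h0 μ' hμequiv hμS
  obtain ⟨h, hh⟩ := hresPb_surj (eaut (resP a))
  have hca : μ ((artinEquiv B).symm h) = χ a :=
    hμ_of _ a (by rw [MulEquiv.apply_symm_apply, hh, MulEquiv.symm_apply_apply])
  rw [← hca]
  exact DFunLike.congr_fun hμ0 (Additive.ofMul ((artinEquiv B).symm h))

/-- **THE EQUIVARIANT IWASAWA LEMMA with the base hypothesis on the `S`-split class group.**  As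
`equivariantHom_classGroup_eq_zero_of_cyclic_layer_of_classGroup` (file III): `k ⊆ B ⊆ F` number fields,
`F/k`, `B/k` Galois, `[F : B] = p`, `Gal(F/B)` central, `F/B` unramified at infinity, `V` a `p`-torsion
`Γ`-module through `π : Γ ↠ Gal(F/k)` with `Gal(F/B)` acting trivially, (c3*) at the primes of `F` ramified
over `B` and one ramified prime with a number of conjugates prime to `p` — but with (c2*) WEAKENED to the
printed (c2) of Deo–Ray–Sujatha: every `Γ`-equivariant additive `μ : Cl(𝓞_B) → V` KILLING THE CLASSES OF A
SET `bad` OF PLACES OF `B` is zero, at the price of (c3*) at the primes of `F` above the bad places.  Then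
every `Γ`-equivariant additive `f : Cl(𝓞_F) → V` is zero.  (File II's group step composed with
`inertiaTrivialHom_eq_zero_of_classGroupHom_eq_zero_of_splitAt`.)
[cite: Washington1997, §13.3 Lemmas 13.14–13.15 and Thm. 10.4 (proof)]
[cite: NeukirchANT1999, Ch. VI (6.9), (7.1), Ch. IV §6 and Ch. I §9 (9.4)–(9.6)]
[cite: DeoRaySujatha2023, §3 Thm. 3.8 (c2), (c3) (arXiv:2202.09937 p. 9)] -/
theorem equivariantHom_classGroup_eq_zero_of_cyclic_layer_of_classGroup_of_splitAt (p : ℕ) [Fact p.Prime]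
    (hdeg : Module.finrank B F = p)
    (hcent : ∀ (σ : F ≃ₐ[B] F) (τ : F ≃ₐ[k] F) (x : F), τ (σ x) = σ (τ x))
    {Γ : Type*} [Group Γ] (π : Γ →* (F ≃ₐ[k] F)) (hπ : Function.Surjective π)
    {V : Type*} [AddCommGroup V] [DistribMulAction Γ V] (hpV : ∀ v : V, p • v = 0)
    (hV : ∀ τ : Γ, (∀ x : B, π τ (algebraMap B F x) = algebraMap B F x) → ∀ v : V, τ • v = v)
    (bad : HeightOneSpectrum (𝓞 B) → Prop)
    (hDbad : ∀ (𝔓 : Ideal (𝓞 F)) [𝔓.IsMaximal] (v : HeightOneSpectrum (𝓞 B)), bad v →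
      𝔓.under (𝓞 B) = v.asIdeal → ∀ x : V, (∀ τ : Γ, π τ • 𝔓 = 𝔓 → τ • x = x) → x = 0)
    (h0 : ∀ μ : Additive (ClassGroup (𝓞 B)) →+ V,
      (∀ (τ : Γ) (c : ClassGroup (𝓞 B)),
        μ (Additive.ofMul (ClassGroup.mulEquiv (AmbiguousClass.intAut ((π τ).restrictNormal B)) c)) =
          τ • μ (Additive.ofMul c)) →
      (∀ v : HeightOneSpectrum (𝓞 B), bad v →
        μ (Additive.ofMul (ClassGroup.mk0 ⟨v.asIdeal, mem_nonZeroDivisors_of_ne_zero v.ne_bot⟩)) = 0) →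
      μ = 0)
    (hD : ∀ (𝔓 : Ideal (𝓞 F)) [𝔓.IsMaximal], 𝔓.ramificationIdx (𝓞 B) ≠ 1 →
      ∀ v : V, (∀ τ : Γ, π τ • 𝔓 = 𝔓 → τ • v = v) → v = 0)
    (horb : ∃ (𝔓₀ : Ideal (𝓞 F)) (_ : 𝔓₀.IsMaximal), 𝔓₀.ramificationIdx (𝓞 B) ≠ 1 ∧
      ¬ p ∣ (MulAction.stabilizer (F ≃ₐ[k] F) 𝔓₀).index)
    (f : Additive (ClassGroup (𝓞 F)) →+ V)
    (hf : ∀ (τ : Γ) (c : ClassGroup (𝓞 F)),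
      f (Additive.ofMul (ClassGroup.mulEquiv (AmbiguousClass.intAut (π τ)) c)) = τ • f (Additive.ofMul c)) :
    f = 0 :=
  equivariantHom_classGroup_eq_zero_of_cyclic_layer p hdeg hcent π hπ hpV hV hD horb
    (fun χ hχadd hχI hχequiv =>
      inertiaTrivialHom_eq_zero_of_classGroupHom_eq_zero_of_splitAt π hπ bad hDbad h0 χ hχadd
        (fun Q _ => hχI Q) hχequiv)
    f hf

end ClassGroupS

end EquivariantIwasawaLemma

end Literature.NumberTheory.NumberFields

end
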